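import Summits.QuantumAdvantage.QuantumAdvantage.Theses.MobiusLadder
import Literature.NumberTheory.Sieve.MoebiusWalshCircuitsLiouvilleHolds
import HarnessLib

/-!
# Route MobiusLadder — `WalshLiouvilleBound` (item stmt-QuantumAdvantage-1390)

Bourgain's Möbius–Walsh bound in Liouville form, exponent left free:
`∃ c > 0, ∀ᶠ n, ∀ S ⊆ {0,…,n-1}, |∑_{N<2ⁿ} λ(N) w_S(bits N)| ≤ 2^{n - n^c}`.

This is, verbatim up to the (definitionally identical) cast `((λ N : ℤ) : ℝ)`, the Literature named
fact `Literature.NumberTheory.Sieve.bourgain_liouville_walsh` (Bourgain 2013, J. Anal. Math. 119,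
Theorem 1, Liouville remark), which is PROVED in the tree as
`Literature.NumberTheory.Sieve.bourgain_liouville_walsh_holds` (via
`Literature.NumberTheory.LFunctions.bourgain_liouville_walsh_uniform_holds`, exponent `c = 1/10`:
Green's Proposition 1 for small weights, the Vaughan-type reduction for `λ`, Bourgain's type-I/II
box estimates). This file transports that discharge to the route decl.
-/

set_option linter.dupNamespace false -- D-0017: single-problem summit ⇒ `QuantumAdvantage.QuantumAdvantage` by design

namespace Summit.QuantumAdvantage.QuantumAdvantage.Theorems.MobiusLadder

open Summit.QuantumAdvantage.QuantumAdvantage.Theses.MobiusLadder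

/-- **`WalshLiouvilleBound` holds** (item stmt-QuantumAdvantage-1390 of route MobiusLadder):
there is `c > 0` such that for all sufficiently large `n` and every `S : Finset (Fin n)`,
`|∑_{N < 2ⁿ} λ(N) · walsh S (bits N)| ≤ 2^{n - n^c}`. Direct transport of the proved Literature
theorem `Literature.NumberTheory.Sieve.bourgain_liouville_walsh_holds` (Bourgain 2013, Theorem 1,
Liouville form; `c = 1/10`). -/
theorem walshLiouvilleBound_proof : WalshLiouvilleBound := by
  unfold WalshLiouvilleBound
  exact Literature.NumberTheory.Sieve.bourgain_liouville_walsh_holds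

end Summit.QuantumAdvantage.QuantumAdvantage.Theorems.MobiusLadder
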